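import Literature.NumberTheory.GaloisRepresentations.SubgroupKummerMu
import Literature.Algebra.InverseSystem.DirectedSystemKonig
import HarnessLib

/-!
# Norm-coherent `N`-th roots along a tower of layers: Kőnig's lemma for Kummer theory

Topic `Literature/NumberTheory/GaloisRepresentations` (sequel of `SubgroupKummerMu`).  THEOREMS ONLY (no definition, no named
fact, no instance, no `sorry`).  Setting: a field `K`, `Γ_K` acting on `K̄`, a TOWER of subgroups `H (m+1) ≤ H m ≤ Γ_K` with finite
steps `H m / H (m+1)` and sections `t m` (the layers `L_m = K̄^{H m}`), and the COSET NORMS `N_m(z) = ∏_{x ∈ H m/H (m+1)} t m(x)·z`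
of `H (m+1)`-fixed elements (the field norms `N_{L_{m+1}/L_m}`; `SubgroupKummerMu.prod_smul_mem_subgroupKummerUnits`).
* §1 `forall_smul_prod_smul_eq` (the coset norm of an `H (m+1)`-fixed unit is `H m`-fixed), `prod_smul_eq_of_forall_smul_eq`
  (independence of the section), `finite_fixed_roots` (the `H`-fixed `N`-th roots of a given unit form a finite set).
* §2 `exists_seq_of_forall_finite_nonempty` — Kőnig's lemma for an `ℕ`-tower of finite non-empty types with one-step maps
  (from the tree's `InverseSystem.exists_compatible_mem_of_finite`).
* §3 ★ `exists_normCoherent_roots` — if a norm-coherent family `C m ∈ (K̄^{H m})ˣ` (`N_m(C (m+1)) = C m`) admits at EVERY level an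
  `H m`-fixed `N`-th root, then it admits a NORM-COHERENT family of such roots `a m` (`a m ^ N = C m`, `N_m(a (m+1)) = a m`):
  the sets of fixed roots are finite and non-empty and `N_m` maps one into the next.  This is the compactness step of
  «`b` is an `N`-th power in every layer `L_m` ⇒ the norm-coherent family `(b_m)` is an `N`-th power in `lim← L_mˣ`» (Rubin,
  LNM 1716, proof of Thm. 7.11 / Lemma 9.3: passage to `U_∞ = lim← U_n`; Kato §15.5 norm-compatible elliptic units).
## References
* K. Rubin, *Elliptic curves with complex multiplication and the conjecture of Birch and Swinnerton-Dyer*, LNM 1716 (1999),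
  §7 (U_∞ = lim← U_n), Lemma 9.3. [Rubin1999]
* L. Ribes, P. Zalesskii, *Profinite Groups* (2010), Prop. 1.1.4 (inverse limits of non-empty finite sets). [RibesZalesskii2010]
* J.-P. Serre, *Local Fields* (1979), X §3 b) (cor in degree 0 is the norm). [Serre1979]
-/

noncomputable section

namespace Literature.NumberTheory.GaloisRepresentations

open Field

/-! ## §1 Coset norms of fixed elements -/

section CosetNorm

variable {K : Type} [Field K] {V H : Subgroup (absoluteGaloisGroup K)} [Fintype (H ⧸ V.subgroupOf H)]
  {t : H ⧸ V.subgroupOf H → H}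

/-- **The coset norm `∏ₓ t(x)·z` of a `V`-fixed unit is `H`-fixed** (any section `t` of `H → H/V`; `V ≤ H` intended).
[cite: Serre1979, X §3 b)] -/
theorem forall_smul_prod_smul_eq (ht : ∀ x, (t x : H ⧸ V.subgroupOf H) = x) {z : (AlgebraicClosure K)ˣ}
    (hz : ∀ σ : V, (σ : absoluteGaloisGroup K) • z = z) (τ : H) :
    (τ : absoluteGaloisGroup K) • (∏ x, ((t x : H) : absoluteGaloisGroup K) • z) = ∏ x, ((t x : H) : absoluteGaloisGroup K) • z := by
  haveI : NeZero (1 : ℕ) := ⟨one_ne_zero⟩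
  have h := prod_smul_mem_subgroupKummerUnits (N := 1) ht (mem_subgroupKummerUnits_of_forall_smul_eq (N := 1) hz) τ
  simpa only [pow_one] using h

omit [Fintype (H ⧸ V.subgroupOf H)] in
/-- **Independence of the section**: two sections of `H → H/V` give the same coset norm of a `V`-fixed unit.
[cite: Serre1979, X §3 b)] -/
theorem prod_smul_eq_of_forall_smul_eq [Fintype (H ⧸ V.subgroupOf H)] {t t' : H ⧸ V.subgroupOf H → H}
    (ht : ∀ x, (t x : H ⧸ V.subgroupOf H) = x) (ht' : ∀ x, (t' x : H ⧸ V.subgroupOf H) = x)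
    {z : (AlgebraicClosure K)ˣ} (hz : ∀ σ : V, (σ : absoluteGaloisGroup K) • z = z) :
    ∏ x, ((t x : H) : absoluteGaloisGroup K) • z = ∏ x, ((t' x : H) : absoluteGaloisGroup K) • z := by
  refine Finset.prod_congr rfl fun x _ ↦ ?_
  -- `t x = t' x · v` with `v ∈ V`
  have hmem : (t' x)⁻¹ * t x ∈ V.subgroupOf H := by
    rw [← QuotientGroup.eq, ht' x, ht x]
  rw [Subgroup.mem_subgroupOf, Subgroup.coe_mul, Subgroup.coe_inv] at hmem
  have h := hz ⟨_, hmem⟩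
  change (((t' x : H) : absoluteGaloisGroup K)⁻¹ * ((t x : H) : absoluteGaloisGroup K)) • z = z at h
  rw [mul_smul, inv_smul_eq_iff] at h
  exact h

omit [Fintype (H ⧸ V.subgroupOf H)] in
/-- **Finitely many fixed `N`-th roots**: the units `a` of `K̄` with `a ^ N = C` (let alone the `H`-fixed ones) form a finite set
(`X^N − C` has at most `N` roots). [cite: Serre1979, X §3 b)] -/
theorem finite_roots {N : ℕ} (hN : 0 < N) (C : (AlgebraicClosure K)ˣ) : {a : (AlgebraicClosure K)ˣ | a ^ N = C}.Finite := by
  classical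
  have hfin : {x : AlgebraicClosure K | x ^ N = (C : AlgebraicClosure K)}.Finite := by
    refine (Polynomial.nthRootsFinset N (C : AlgebraicClosure K)).finite_toSet.subset fun x hx ↦ ?_
    rw [Finset.mem_coe, Polynomial.mem_nthRootsFinset hN]
    exact hx
  refine (hfin.preimage Units.val_injective.injOn).subset fun a ha ↦ ?_
  change ((a : (AlgebraicClosure K)ˣ) : AlgebraicClosure K) ^ N = C
  rw [← Units.val_pow_eq_pow_val, (show a ^ N = C from ha)]

end CosetNorm

/-! ## §2 Kőnig's lemma for `ℕ`-towers of finite non-empty types -/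

section Konig

universe v

/-- **Kőnig's lemma, tower form**: for finite non-empty types `S m` and maps `f m : S (m+1) → S m` there is a compatible sequence
`y m ∈ S m`, `f m (y (m+1)) = y m` (iterate the maps to a functorial inverse system and apply `InverseSystem.exists_compatible_mem_of_finite`).
[cite: RibesZalesskii2010, Prop. 1.1.4] -/
theorem exists_seq_of_forall_finite_nonempty {S : ℕ → Type v} [∀ m, Finite (S m)] [∀ m, Nonempty (S m)]
    (f : ∀ m, S (m + 1) → S m) : ∃ y : ∀ m, S m, ∀ m, f m (y (m + 1)) = y m := by
  -- iterates
  let T : ∀ ⦃i j : ℕ⦄, i ≤ j → S j → S i := fun i j h ↦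
    Nat.leRec (motive := fun j _ ↦ S j → S i) id (fun k _ g ↦ g ∘ f k) h
  have T_self : ∀ (i : ℕ) (y : S i), T le_rfl y = y := fun i y ↦ by
    simp only [T, Nat.leRec_self, id]
  have T_succ : ∀ ⦃i k : ℕ⦄ (h : i ≤ k) (h' : i ≤ k + 1) (y : S (k + 1)), T h' y = T h (f k y) := fun i k h h' y ↦ by
    simp only [T]
    rw [Nat.leRec_succ (h1 := h)]
    rfl
  have T_comp : ∀ ⦃i j k : ℕ⦄ (hij : i ≤ j) (hjk : j ≤ k) (y : S k), T hij (T hjk y) = T (hij.trans hjk) y := by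
    intro i j k hij hjk
    induction k, hjk using Nat.le_induction with
    | base => intro y; rw [T_self]
    | succ k hjk ih =>
      intro y
      rw [T_succ hjk (Nat.le_succ_of_le hjk) y, ih (f k y), ← T_succ (hij.trans hjk) (hij.trans (Nat.le_succ_of_le hjk)) y]
  obtain ⟨y, -, hy⟩ := Literature.Algebra.InverseSystem.exists_compatible_mem_of_finite T T_self T_comp (fun _ ↦ Set.univ)
    (fun _ ↦ Set.finite_univ) (fun _ ↦ Set.univ_nonempty) (fun _ _ _ _ _ ↦ Set.mem_univ _)
  refine ⟨y, fun m ↦ ?_⟩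
  have h := hy (Nat.le_succ m)
  rwa [T_succ le_rfl (Nat.le_succ m), T_self] at h

end Konig

/-! ## §3 Norm-coherent roots -/

section Roots

variable {K : Type} [Field K] (N : ℕ) [NeZero N]
  (H : ℕ → Subgroup (absoluteGaloisGroup K)) [∀ m, Fintype (H m ⧸ (H (m + 1)).subgroupOf (H m))]
  (t : ∀ m, H m ⧸ (H (m + 1)).subgroupOf (H m) → H m)

/-- ★ **Norm-coherent `N`-th roots exist as soon as roots exist levelwise** (Kőnig).  For a family of units `C m` fixed by `H m`
and norm-coherent (`∏_{x ∈ H m/H (m+1)} t m(x)·C (m+1) = C m`), if every `C m` has an `H m`-fixed `N`-th root, then there are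
`H m`-fixed `N`-th roots `a m` of the `C m` with `∏ₓ t m(x)·a (m+1) = a m` for all `m`.
[cite: Rubin1999, §7 (U_∞ = lim← U_n) and Lemma 9.3] [cite: RibesZalesskii2010, Prop. 1.1.4] -/
theorem exists_normCoherent_roots (ht : ∀ m x, (t m x : H m ⧸ (H (m + 1)).subgroupOf (H m)) = x)
    (C : ℕ → (AlgebraicClosure K)ˣ)
    (hCnorm : ∀ m, ∏ x, ((t m x : H m) : absoluteGaloisGroup K) • C (m + 1) = C m)
    (hroot : ∀ m, ∃ a : (AlgebraicClosure K)ˣ, (∀ σ : H m, (σ : absoluteGaloisGroup K) • a = a) ∧ a ^ N = C m) :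
    ∃ a : ℕ → (AlgebraicClosure K)ˣ, (∀ m (σ : H m), (σ : absoluteGaloisGroup K) • a m = a m) ∧ (∀ m, a m ^ N = C m) ∧
      ∀ m, ∏ x, ((t m x : H m) : absoluteGaloisGroup K) • a (m + 1) = a m := by
  -- the finite non-empty sets of fixed roots and the norm maps between them
  let S : ℕ → Type := fun m ↦ {a : (AlgebraicClosure K)ˣ // (∀ σ : H m, (σ : absoluteGaloisGroup K) • a = a) ∧ a ^ N = C m}
  haveI : ∀ m, Finite (S m) := fun m ↦ by
    have hfin := (finite_roots (NeZero.pos N) (C m)).to_subtype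
    exact Finite.of_injective (fun a : S m ↦ (⟨a.1, a.2.2⟩ : {a : (AlgebraicClosure K)ˣ | a ^ N = C m}))
      fun a b h ↦ Subtype.ext (by simpa using congrArg Subtype.val h)
  haveI : ∀ m, Nonempty (S m) := fun m ↦ by
    obtain ⟨a, ha, haN⟩ := hroot m
    exact ⟨⟨a, ha, haN⟩⟩
  let f : ∀ m, S (m + 1) → S m := fun m a ↦
    ⟨∏ x, ((t m x : H m) : absoluteGaloisGroup K) • a.1,
      fun σ ↦ forall_smul_prod_smul_eq (ht m) a.2.1 σ,
      by rw [prod_smul_pow_eq, a.2.2, hCnorm m]⟩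
  obtain ⟨y, hy⟩ := exists_seq_of_forall_finite_nonempty f
  exact ⟨fun m ↦ (y m).1, fun m ↦ (y m).2.1, fun m ↦ (y m).2.2, fun m ↦ congrArg Subtype.val (hy m)⟩

end Roots

end Literature.NumberTheory.GaloisRepresentations

end
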